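import Summits.Ventures.HSemireg.DividedSquareLemma

/-!
# Divided powers of integral 2-forms exist in the 2-vector algebra (pub-hsemireg, S4-PUSH corner 2)

Kernel leg of seat s4-search-2 gen 16 (cell `pub-hsemireg`), towards the SECOND GIVEN of the (2,2,3,3,3,3) edge unit's
CLASS-DEAD route (`s4push/search-2/g15/READING-GUIDE.md`, PEN-NOTE g15 DELTA 6): «the identification of the registered
closed forms with the actual divided powers».  CRITERION L (PREREG-S2-18∕19; memo `s4push/search-2/g11/LIFT2-search-2-g11.md`)
is stated with the divided powers `B^[2] = B²∕2`, `B^[3] = B³∕6` of an INTEGRAL 2-form `B` in `Λ^{ev}ℤ¹²`; the tree files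
(`DegreeSixSecondDigit`, `TwoSlotGlue`, gen 15's rows) work with REGISTERED CLOSED FORMS (`B₂`, `B₃`, `C₂`, `E`, `E₃`, …)
pinned by identities `k!·X_k = X^k` (`sq_B`, `cube_B`, `sq_C`, …), uniqueness being torsion-freeness
(`LeadingDigitRemainder.natCast_mul_cancel`).  What a composition of the branch theorems for ONE integral 2-form needs in
addition is EXISTENCE: every integral 2-form — more generally every element of the span of the 2-vectors `ι u · ι v` —
has a divided square and a divided cube INSIDE the 2-vector subalgebra `Λ = Algebra.adjoin R {ι u · ι v}` (for the
first digit `X`, the tail `Z = X + 2Y`, and the remainder produced by `EdgeDigitParametrisation`).  That is this file.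

**Proved (theorems only, count-neutral; no `def`; any commutative ring `R`, any module `M`, no basis).**
§1 (any ring `A`): for a finite family `t : ι → A` over a linear order whose members pairwise commute and square to
zero, `(Σ t)·(Σ t) = 2·Σ_{a<b} t_a t_b` (`sum_mul_sum_eq_two_mul`) and `(Σ t)·(Σ t)·(Σ t) = 6·Σ_{a<b<c} t_a t_b t_c`
(`sum_mul_sum_mul_sum_eq_six_mul`) — the sums written with `if … then … else 0` over `Finset.univ`.
§2 (`ExteriorAlgebra R M`): 2-vectors `ι u · ι v` commute with everything and square to zero
(`DividedSquareLemma.ι_mul_ι_mul_comm`, `DividedSquareLemma.ι₄_eq_zero_13`), so §1 applies to any finite family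
`k ↦ c_k • (ι u_k · ι v_k)` (`smul_twoVector_sq`, `smul_twoVector_comm`); `exists_dividedPowers_of_mem_span`: every
`X ∈ Submodule.span R {ι u · ι v}` has `X₂, X₃ ∈ Λ` with `X·X = 2·X₂` and `X·X·X = 6·X₃`; `mem_adjoin_of_mem_span`:
such an `X` lies in `Λ` itself.

NOT here: the composition of the branch theorems (gen 15's rows A–F + `LeadingDigitCoverage`) into one statement for one
integral 2-form; uniqueness (already `natCast_mul_cancel`).  Honest framing: elementary algebra in the exterior algebra
(theorems only, count-neutral); infrastructure for a kernel check of a CLASS-LEVEL necessary-condition sieve at the special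
fibre `E⁶`; no object, no `σ` computation, no Hodge statement; nothing here bears on HC ∕ HC_CM ∕ HC_AV.
-/

namespace Summit.Ventures.HSemireg.TwoVectorDividedPowers

section Generic

/-! ### 1. Squares and cubes of a commuting square-zero family -/

variable {ι A : Type*} [LinearOrder ι] [Fintype ι] [Ring A]

/-- **`(Σ t)² = 2·e₂`.**  For a finite family `t` over a linear order with `t_a·t_a = 0` and `t_a·t_b = t_b·t_a`:
`(Σ_a t_a)·(Σ_a t_a) = 2·Σ_a Σ_b [a < b] t_a t_b`.  (Expand, drop the diagonal, fold the two off-diagonal halves.) -/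
theorem sum_mul_sum_eq_two_mul (t : ι → A) (hsq : ∀ a, t a * t a = 0) (hcomm : ∀ a b, t a * t b = t b * t a) :
    (∑ a, t a) * (∑ a, t a) = 2 * ∑ a, ∑ b, if a < b then t a * t b else 0 := by
  have split : ∀ a b, t a * t b =
      (if a < b then t a * t b else 0) + ((if b < a then t a * t b else 0) + if a = b then t a * t b else 0) := by
    intro a b
    rcases lt_trichotomy a b with h | rfl | h
    · rw [if_pos h, if_neg (lt_asymm h), if_neg (ne_of_lt h), add_zero, add_zero]
    · rw [if_neg (lt_irrefl a), if_pos rfl, hsq, add_zero, zero_add]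
    · rw [if_neg (lt_asymm h), if_pos h, if_neg (ne_of_gt h), add_zero, zero_add]
  have hs : (∑ a, ∑ b, t a * t b) = ∑ a, ∑ b, ((if a < b then t a * t b else 0) +
      ((if b < a then t a * t b else 0) + if a = b then t a * t b else 0)) :=
    Finset.sum_congr rfl fun a _ => Finset.sum_congr rfl fun b _ => split a b
  rw [Fintype.sum_mul_sum, hs]
  simp only [Finset.sum_add_distrib]
  have hD : (∑ a, ∑ b, if a = b then t a * t b else 0) = 0 := by
    refine Finset.sum_eq_zero fun a _ => ?_
    rw [Finset.sum_ite_eq, if_pos (Finset.mem_univ a), hsq]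
  have hG : (∑ a, ∑ b, if b < a then t a * t b else 0) = ∑ a, ∑ b, if a < b then t a * t b else 0 := by
    rw [Finset.sum_comm]
    refine Finset.sum_congr rfl fun a _ => Finset.sum_congr rfl fun b _ => ?_
    split_ifs
    · exact hcomm b a
    · rfl
  rw [hD, hG, add_zero, two_mul]

/-- **`(Σ t)³ = 6·e₃`.**  Same hypotheses: `(Σ t)·(Σ t)·(Σ t) = 6·Σ_a Σ_b Σ_c [a < b < c] t_a t_b t_c`.
(`(Σt)²·(Σt) = 2·Σ_{a<b} Σ_c t_a t_b t_c`; for `a < b` the terms `c = a`, `c = b` vanish and the three regions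
`c < a`, `a < c < b`, `b < c` each re-index to `Σ_{a<b<c}`.) -/
theorem sum_mul_sum_mul_sum_eq_six_mul (t : ι → A) (hsq : ∀ a, t a * t a = 0)
    (hcomm : ∀ a b, t a * t b = t b * t a) :
    (∑ a, t a) * (∑ a, t a) * (∑ a, t a) =
      6 * ∑ a, ∑ b, ∑ c, if a < b ∧ b < c then t a * t b * t c else 0 := by
  -- the two vanishing diagonals
  have d₁ : ∀ a b, t a * t b * t a = 0 := fun a b => by
    rw [mul_assoc, hcomm b a, ← mul_assoc, hsq, zero_mul]
  have d₂ : ∀ a b, t a * t b * t b = 0 := fun a b => by rw [mul_assoc, hsq, mul_zero]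
  -- pointwise split of the summand of `(Σt)²·(Σt)`
  have split : ∀ a b c, (if a < b then t a * t b * t c else 0) =
      (if c < a ∧ a < b then t a * t b * t c else 0) +
        ((if a < c ∧ c < b then t a * t b * t c else 0) + if a < b ∧ b < c then t a * t b * t c else 0) := by
    intro a b c
    by_cases hab : a < b
    · rw [if_pos hab]
      rcases lt_trichotomy c a with hca | rfl | hac
      · rw [if_pos ⟨hca, hab⟩, if_neg (fun h => lt_asymm hca h.1),
          if_neg (fun h => lt_asymm (lt_trans hca hab) h.2), add_zero, add_zero]
      · -- `c = a`: the first two conditions coincide (`a < a ∧ a < b`)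
        rw [d₁, if_neg (fun h => lt_irrefl _ h.1), if_neg (fun h => lt_asymm h.1 h.2), add_zero, add_zero]
      · rcases lt_trichotomy c b with hcb | rfl | hbc
        · rw [if_neg (fun h => lt_asymm hac h.1), if_pos ⟨hac, hcb⟩, if_neg (fun h => lt_asymm hcb h.2),
            zero_add, add_zero]
        · -- `c = b`: the last two conditions coincide (`a < b ∧ b < b`)
          rw [d₂, if_neg (fun h => lt_asymm hac h.1), if_neg (fun h => lt_irrefl _ h.2), add_zero, add_zero]
        · rw [if_neg (fun h => lt_asymm hac h.1), if_neg (fun h => lt_asymm hbc h.2), if_pos ⟨hab, hbc⟩,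
            zero_add, zero_add]
    · rw [if_neg hab, if_neg (fun h => hab h.2), if_neg (fun h => hab (lt_trans h.1 h.2)),
        if_neg (fun h => hab h.1), add_zero, add_zero]
  -- `(Σt)²·(Σt) = 2·Σ_a Σ_b Σ_c [a<b] t_a t_b t_c`, then split
  have hQ : (∑ a, ∑ b, if a < b then t a * t b else 0) * (∑ a, t a) =
      ∑ a, ∑ b, ∑ c, if a < b then t a * t b * t c else 0 := by
    rw [Finset.sum_mul]; refine Finset.sum_congr rfl fun a _ => ?_
    rw [Finset.sum_mul]; refine Finset.sum_congr rfl fun b _ => ?_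
    rw [Finset.mul_sum]; refine Finset.sum_congr rfl fun c _ => ?_
    rw [ite_zero_mul]
  have hS : (∑ a, ∑ b, ∑ c, if a < b then t a * t b * t c else 0) =
      (∑ a, ∑ b, ∑ c, if c < a ∧ a < b then t a * t b * t c else 0) +
        ((∑ a, ∑ b, ∑ c, if a < c ∧ c < b then t a * t b * t c else 0) +
          ∑ a, ∑ b, ∑ c, if a < b ∧ b < c then t a * t b * t c else 0) := by
    rw [Finset.sum_congr rfl fun a _ => Finset.sum_congr rfl fun b _ => Finset.sum_congr rfl fun c _ =>
      split a b c]
    simp only [Finset.sum_add_distrib]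
  -- the three regions
  have hR₁ : (∑ a, ∑ b, ∑ c, if c < a ∧ a < b then t a * t b * t c else 0) =
      ∑ a, ∑ b, ∑ c, if a < b ∧ b < c then t a * t b * t c else 0 := by
    calc (∑ a, ∑ b, ∑ c, if c < a ∧ a < b then t a * t b * t c else 0)
        = ∑ a, ∑ c, ∑ b, if c < a ∧ a < b then t a * t b * t c else 0 :=
          Finset.sum_congr rfl fun a _ => Finset.sum_comm
      _ = ∑ c, ∑ a, ∑ b, if c < a ∧ a < b then t a * t b * t c else 0 := Finset.sum_comm
      _ = ∑ c, ∑ a, ∑ b, if c < a ∧ a < b then t c * t a * t b else 0 := by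
          refine Finset.sum_congr rfl fun c _ => Finset.sum_congr rfl fun a _ =>
            Finset.sum_congr rfl fun b _ => ?_
          split_ifs
          · rw [mul_assoc, hcomm b c, ← mul_assoc, hcomm a c, mul_assoc]
          · rfl
  have hR₂ : (∑ a, ∑ b, ∑ c, if a < c ∧ c < b then t a * t b * t c else 0) =
      ∑ a, ∑ b, ∑ c, if a < b ∧ b < c then t a * t b * t c else 0 := by
    calc (∑ a, ∑ b, ∑ c, if a < c ∧ c < b then t a * t b * t c else 0)
        = ∑ a, ∑ c, ∑ b, if a < c ∧ c < b then t a * t b * t c else 0 :=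
          Finset.sum_congr rfl fun a _ => Finset.sum_comm
      _ = ∑ a, ∑ c, ∑ b, if a < c ∧ c < b then t a * t c * t b else 0 := by
          refine Finset.sum_congr rfl fun a _ => Finset.sum_congr rfl fun c _ =>
            Finset.sum_congr rfl fun b _ => ?_
          split_ifs
          · rw [mul_assoc, hcomm b c, ← mul_assoc]
          · rfl
  rw [sum_mul_sum_eq_two_mul t hsq hcomm, mul_assoc, hQ, hS, hR₁, hR₂]
  noncomm_ring

end Generic

section Exterior

/-! ### 2. In `ExteriorAlgebra R M`: multiples of 2-vectors, and divided powers of elements of their span -/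

open ExteriorAlgebra (ι)
open DividedSquareLemma

variable {R : Type*} [CommRing R] {M : Type*} [AddCommGroup M] [Module R M]

/-- A multiple of a 2-vector squares to zero: `(c • ι u ι v)·(c • ι u ι v) = 0`
(`DividedSquareLemma.ι₄_eq_zero_13`). -/
theorem smul_twoVector_sq (c : R) (u v : M) :
    (c • (ι R u * ι R v)) * (c • (ι R u * ι R v)) = 0 := by
  rw [smul_mul_smul_comm, ι₄_eq_zero_13, smul_zero]

/-- Multiples of 2-vectors commute with everything, in particular with each other
(`DividedSquareLemma.ι_mul_ι_mul_comm`). -/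
theorem smul_twoVector_comm (c : R) (u v : M) (y : ExteriorAlgebra R M) :
    (c • (ι R u * ι R v)) * y = y * (c • (ι R u * ι R v)) := by
  rw [smul_mul_assoc, mul_smul_comm, ι_mul_ι_mul_comm]

/-- The span of the 2-vectors lies in the subalgebra they generate (`Λ`, the 2-vector = even subalgebra of
`TwoSlotGlue`). -/
theorem mem_adjoin_of_mem_span (X : ExteriorAlgebra R M)
    (hX : X ∈ Submodule.span R (Set.range fun p : M × M => ι R p.1 * ι R p.2)) :
    X ∈ Algebra.adjoin R (Set.range fun p : M × M => ι R p.1 * ι R p.2) :=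
  Algebra.span_le_adjoin R _ hX

/-- **Divided square and cube exist in `Λ`.**  Every `X` in the `R`-span of the 2-vectors `ι u · ι v` (every
«integral 2-form» when `R = ℤ` and `u, v` run through a basis) has `X₂, X₃` in the 2-vector subalgebra
`Λ = Algebra.adjoin R {ι u · ι v}` with `X·X = 2·X₂` and `X·X·X = 6·X₃` — the divided powers `X^[2]`, `X^[3]` of
CRITERION L exist inside `Λ` (they are unique there when `Λ` is torsion-free, `LeadingDigitRemainder.natCast_mul_cancel`).
Proof: write `X` as a finite combination (`Finsupp.mem_span_range_iff_exists_finsupp`), enumerate its support by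
`Fin n`, and apply §1 to `k ↦ c_k • ι u_k ι v_k`. -/
theorem exists_dividedPowers_of_mem_span (X : ExteriorAlgebra R M)
    (hX : X ∈ Submodule.span R (Set.range fun p : M × M => ι R p.1 * ι R p.2)) :
    ∃ X₂ ∈ Algebra.adjoin R (Set.range fun p : M × M => ι R p.1 * ι R p.2),
      ∃ X₃ ∈ Algebra.adjoin R (Set.range fun p : M × M => ι R p.1 * ι R p.2),
        X * X = 2 * X₂ ∧ X * X * X = 6 * X₃ := by
  set Λ := Algebra.adjoin R (Set.range fun p : M × M => ι R p.1 * ι R p.2)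
  obtain ⟨c, rfl⟩ := Finsupp.mem_span_range_iff_exists_finsupp.mp hX
  -- enumerate the support
  set s := c.support
  set e := s.equivFin
  set t : Fin s.card → ExteriorAlgebra R M := fun k => c (e.symm k) • (ι R (e.symm k).1.1 * ι R (e.symm k).1.2)
  have hsum : (c.sum fun p a => a • (ι R p.1 * ι R p.2)) = ∑ k, t k := by
    rw [Finsupp.sum, ← Finset.sum_coe_sort]
    exact Fintype.sum_equiv e _ _ fun p => by simp [t]
  have hsq : ∀ k, t k * t k = 0 := fun k => smul_twoVector_sq _ _ _
  have hcomm : ∀ k l, t k * t l = t l * t k := fun k l => smul_twoVector_comm _ _ _ _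
  have memt : ∀ k, t k ∈ Λ := fun k =>
    Λ.smul_mem (Algebra.subset_adjoin ⟨((e.symm k).1.1, (e.symm k).1.2), rfl⟩) _
  refine ⟨∑ a, ∑ b, if a < b then t a * t b else 0, ?_,
    ∑ a, ∑ b, ∑ c', if a < b ∧ b < c' then t a * t b * t c' else 0, ?_, ?_, ?_⟩
  · refine Λ.sum_mem fun a _ => Λ.sum_mem fun b _ => ?_
    split_ifs
    · exact Λ.mul_mem (memt a) (memt b)
    · exact Λ.zero_mem
  · refine Λ.sum_mem fun a _ => Λ.sum_mem fun b _ => Λ.sum_mem fun c' _ => ?_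
    split_ifs
    · exact Λ.mul_mem (Λ.mul_mem (memt a) (memt b)) (memt c')
    · exact Λ.zero_mem
  · rw [hsum]; exact sum_mul_sum_eq_two_mul t hsq hcomm
  · rw [hsum]; exact sum_mul_sum_mul_sum_eq_six_mul t hsq hcomm

/-- **Corollary (the shape used downstream): divided powers of a sum of multiples of basis 2-vectors.**  For any
finite family `q ↦ c q • ι (x (i q)) ι (x (j q))` (e.g. the 66 terms `c i j • ι xᵢ ι xⱼ`, `i < j`, of an integral
2-form on a basis `x : Fin 12 → M`), its sum `X` has `X₂, X₃ ∈ Λ` with `X·X = 2X₂`, `X·X·X = 6X₃`. -/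
theorem exists_dividedPowers_sum_smul {κ ν : Type*} [Fintype κ] (x : ν → M) (i j : κ → ν) (c : κ → R)
    (X : ExteriorAlgebra R M) (hX : X = ∑ q, c q • (ι R (x (i q)) * ι R (x (j q)))) :
    ∃ X₂ ∈ Algebra.adjoin R (Set.range fun p : M × M => ι R p.1 * ι R p.2),
      ∃ X₃ ∈ Algebra.adjoin R (Set.range fun p : M × M => ι R p.1 * ι R p.2),
        X * X = 2 * X₂ ∧ X * X * X = 6 * X₃ := by
  refine exists_dividedPowers_of_mem_span X ?_
  rw [hX]
  refine Submodule.sum_mem _ fun q _ => Submodule.smul_mem _ _ (Submodule.subset_span ⟨(x (i q), x (j q)), rfl⟩)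

end Exterior

end Summit.Ventures.HSemireg.TwoVectorDividedPowers
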